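import Summits.MatrixMultiplication.MatrixMultiplication.Theorems.EdgePencilDefectCuts
import Literature.Computability.AlgebraicComplexity.Coppersmith1982RapidRectangular
import HarnessLib

/-!
# The `(1,1)` re-cut made hypothesis-free and the proved floor of the residual pencil

Support kernel for `stmt-MatrixMultiplication-26697` (`TetraExcessZero : ω(K₄) ≤ ω(2,1,2)`, the attacked
leaf of the cut of record `closes : TetraExcessZero → TetraNoSaving → ω = 2`, route `TetrahedronCarving`
rev. 6; lineage `decomp-mm-lens-6` «barrier-complement carving», generation 22). Companions:
`EdgePencilDefectCone` (defects `d = ω − 2`, `ρ = ω(2,1,2) − 4`, `t = ω(K₄) − 4`; the pencils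
`A_k : t ≤ k·ρ`, `B_c : 4 + c·d ≤ ω(K₄)`; the pricing theorem `A_k ∧ B_c ⟹ ω = 2` for `c > k·κ(a)`,
`κ(a) = (1 − 2a)/(1 − a)`, `0 ≤ a ≤ min(α, 1/2)`), `EdgePencilDefectCuts` (the cuts at the route's
declarations, with `0 < α` or the printed `0.3213 ≤ α` kept as a HYPOTHESIS), `EdgePencilDefectWeb`
(lawful worlds: `B_1` strictly weaker than `B_2 = TetraNoSaving`, `A_2` strictly weaker than `A_1`).
No item is added or changed; the cut of record is untouched.

What this file adds.

* §1 **`α > 0` BY NAME.** The companions kept `0 < dualExponentAlpha` as a hypothesis; it is a tree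
  theorem over every field — Coppersmith 1982, `coppersmith1982_dualExponentAlpha_gt : 0.1722 < α`
  (`Literature/…/Coppersmith1982RapidRectangular`, kernel-checked, `5^861 < 4^1000`). Importing it
  discharges the hypothesis: `dualExponentAlpha_pos`, `coppersmithFloor_le_dualExponentAlpha`.
* §2 **HYPOTHESIS-FREE TWO-LEAF CUTS** (every field for the `ω`-statements, `ℂ` at the route's decls):
  `omega_eq_two_of_excessZero_of_plusTwo'` / `matrixMultiplication_iff_excessZero_and_plusTwo'` —
  **`ω = 2 ⟺ TetraExcessZero ∧ TetraPlusTwo`** with NO side condition (`TetraPlusTwo : ω + 2 ≤ ω(K₄)` is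
  `B_1`, one notch below the residual of record `B_2 = TetraNoSaving : 2ω ≤ ω(K₄)`, and STRICTLY weaker
  relative to everything recorded: `EdgePencilDefectWeb.plusTwoWorld`); dually
  `matrixMultiplication_iff_doubleDefect_and_tetraNoSaving'` — `ω = 2 ⟺ A_2 ∧ TetraNoSaving`.
  So EITHER leaf of the cut of record can be weakened one notch at zero cost in hypotheses; the glue
  `closes (hA : TetraExcessZero) (hB : TetraPlusTwo)` is the two-line term
  `matrixMultiplication_of_excessZero_of_plusTwo' hA hB`.
* §3 **THE PROVED FLOOR OF THE `B`-PENCIL.** With `a = 0.1722`: `κ(0.1722) = 0.6556/0.8278 < 0.792`, so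
  `TetraExcessZero ∧ B_c ⟹ ω = 2` for every `c ≥ 0.792` (`matrixMultiplication_of_excessZero_of_transferGE_floor`)
  and `A_k ∧ TetraNoSaving ⟹ ω = 2` for every `0 ≤ k ≤ 2.525` — unconditionally. (The printed
  `α ≥ 0.321334` [VassilevskaWilliamsXuXuZhou2024], a named fact not a tree theorem, would lower the floor
  to `c ≥ 0.5267`, `EdgePencilDefectCuts.matrixMultiplication_iff_tetraExcessZero_and_transferGE`.) The
  floor is documentation of how far the residual can be pushed with PROVED inputs; the natural notch
  inside it is `c = 1`, i.e. `TetraPlusTwo` — a fixed threshold `c ∈ (0.792, 1)` would be hand-picked.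
(The ceiling of the matrix-multiplication COVER class for the attacked leaf — inside that class the leaf
is summit-equivalent — is the companion `EdgePencilCoverCeiling`, filed separately because this file's
import `Coppersmith1982RapidRectangular` had no olean on the farm at filing time.)

References: Coppersmith 1982 (`α > 0.17227`) [Coppersmith1982]; Lotti–Romani 1983 (`ω(·,·,·)` convex,
homogeneous, symmetric) [LottiRomani1983];
Christandl–Vrana–Zuiddam, arXiv:1609.07476, §1.2–1.3 (graph tensors, `ω(K₄)`) [ChristandlVranaZuiddam2016];
Vassilevska Williams–Xu–Xu–Zhou 2024 (`α > 0.321334`) [VassilevskaWilliamsXuXuZhou2024];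
Brand et al. 2026, Thm. 48 (`ω(K₄) < 4.633908`) [BrandEtAl2026].
-/

noncomputable section

set_option linter.dupNamespace false

open Literature.Computability.AlgebraicComplexity
open Summit.MatrixMultiplication.MatrixMultiplication.Theorems.TetrahedronTensor
open Summit.MatrixMultiplication.MatrixMultiplication.Theses.TetrahedronCarving

namespace Summit.MatrixMultiplication.MatrixMultiplication.Theorems.EdgePencil

section AnyField

variable (F : Type) [Field F]

/-! ## §1 `α > 0` by name (Coppersmith 1982) -/

/-- The tree floor of the dual exponent: `0.1722 ≤ α` over every field. [cite: Coppersmith1982, Thm. 1] -/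
theorem coppersmithFloor_le_dualExponentAlpha : (0.1722 : ℝ) ≤ dualExponentAlpha F :=
  (coppersmith1982_dualExponentAlpha_gt F).le

/-- **`0 < α`** over every field — the hypothesis of the companions' `(1,1)` and `(2,2)` cuts, discharged.
[cite: Coppersmith1982, Thm. 1] -/
theorem dualExponentAlpha_pos : 0 < dualExponentAlpha F :=
  lt_of_lt_of_le (by norm_num) (coppersmithFloor_le_dualExponentAlpha F)

/-- `κ(0.1722) < 0.792`: the chord slope available from the tree floor. -/
theorem kappa_coppersmithFloor_lt : (1 - 2 * (0.1722 : ℝ)) / (1 - 0.1722) < 0.792 := by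
  rw [div_lt_iff₀ (by norm_num)]
  norm_num

/-! ## §2 Hypothesis-free two-leaf cuts over every field -/

/-- **`A_1 ∧ B_1 ⟹ ω = 2`, no side condition**: `ω(K₄) ≤ ω(2,1,2)` and `ω + 2 ≤ ω(K₄)` force `ω = 2`.
[cite: Coppersmith1982, Thm. 1] -/
theorem omega_eq_two_of_excessZero_of_plusTwo' (hA : omegaTetra F ≤ omegaRect F 2 1 2)
    (hB : omega F + 2 ≤ omegaTetra F) : omega F = 2 :=
  omega_eq_two_of_excessZero_of_plusTwo F (dualExponentAlpha_pos F) hA hB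

/-- **`A_2 ∧ B_2 ⟹ ω = 2`, no side condition**: `ω(K₄) + 4 ≤ 2·ω(2,1,2)` and `2ω ≤ ω(K₄)` force `ω = 2`.
[cite: Coppersmith1982, Thm. 1] -/
theorem omega_eq_two_of_doubleDefect_of_noSaving' (hA : omegaTetra F + 4 ≤ 2 * omegaRect F 2 1 2)
    (hB : 2 * omega F ≤ omegaTetra F) : omega F = 2 :=
  omega_eq_two_of_doubleDefect_of_noSaving F (dualExponentAlpha_pos F) hA hB

/-- **The diagonal of the pencils is reached unconditionally**: `A_k ∧ B_c ⟹ ω = 2` whenever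
`0 ≤ k ≤ c`, `0 < c`. [cite: Coppersmith1982, Thm. 1] -/
theorem omega_eq_two_of_defectRatioLE_of_transferGE_of_le' {k c : ℝ} (hk : 0 ≤ k) (hc : 0 < c)
    (hkc : k ≤ c) (hA : omegaTetra F - 4 ≤ k * (omegaRect F 2 1 2 - 4))
    (hB : 4 + c * (omega F - 2) ≤ omegaTetra F) : omega F = 2 :=
  omega_eq_two_of_defectRatioLE_of_transferGE_of_le F (dualExponentAlpha_pos F) hk hc hkc hA hB

/-! ## §3 The proved floor: `c > k·κ(0.1722)`, i.e. `c ≥ 0.792·k` suffices -/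

/-- **Floor of the pricing theorem with proved inputs**: `A_k ∧ B_c ⟹ ω = 2` whenever `0 ≤ k` and
`0.792·k < c` (chord at `a = 0.1722`). [cite: Coppersmith1982, Thm. 1] [cite: LottiRomani1983, §3] -/
theorem omega_eq_two_of_defectRatioLE_of_transferGE_floor {k c : ℝ} (hk : 0 ≤ k) (hkc : 0.792 * k < c)
    (hA : omegaTetra F - 4 ≤ k * (omegaRect F 2 1 2 - 4)) (hB : 4 + c * (omega F - 2) ≤ omegaTetra F) :
    omega F = 2 := by
  have hκ := kappa_coppersmithFloor_lt
  have hkc' : k * ((1 - 2 * (0.1722 : ℝ)) / (1 - 0.1722)) < c :=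
    lt_of_le_of_lt (mul_le_mul_of_nonneg_left hκ.le hk) (by linarith)
  exact omega_eq_two_of_defectRatioLE_of_transferGE F (by norm_num) (by norm_num)
    (coppersmithFloor_le_dualExponentAlpha F) hk hkc' hA hB

/-- `A_1 ∧ B_c ⟹ ω = 2` for every `c ≥ 0.792`, unconditionally. [cite: Coppersmith1982, Thm. 1] -/
theorem omega_eq_two_of_excessZero_of_transferGE_floor {c : ℝ} (hc : 0.792 ≤ c)
    (hA : omegaTetra F ≤ omegaRect F 2 1 2) (hB : 4 + c * (omega F - 2) ≤ omegaTetra F) :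
    omega F = 2 :=
  omega_eq_two_of_defectRatioLE_of_transferGE F (by norm_num) (by norm_num)
    (coppersmithFloor_le_dualExponentAlpha F) zero_le_one
    (by rw [one_mul]; exact lt_of_lt_of_le kappa_coppersmithFloor_lt hc)
    ((defectRatioLE_one_iff F).2 hA) hB

/-- `A_k ∧ TetraNoSaving-shape ⟹ ω = 2` for every `0 ≤ k ≤ 2.525`, unconditionally
(`2.525 · 0.792 < 2`). [cite: Coppersmith1982, Thm. 1] -/
theorem omega_eq_two_of_defectRatioLE_of_noSaving_floor {k : ℝ} (hk : 0 ≤ k) (hk' : k ≤ 2.525)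
    (hA : omegaTetra F - 4 ≤ k * (omegaRect F 2 1 2 - 4)) (hB : 2 * omega F ≤ omegaTetra F) :
    omega F = 2 :=
  omega_eq_two_of_defectRatioLE_of_transferGE_floor F hk (by linarith)
    hA ((transferGE_two_iff F).2 hB)

end AnyField

/-! ## §4 At the route's declarations (`ℂ`) -/

section Route

/-- `AlphaPos` by name: `0 < α(ℂ)`. [cite: Coppersmith1982, Thm. 1] -/
theorem alphaPos : 0 < dualExponentAlpha ℂ := dualExponentAlpha_pos ℂ

/-- **The `(1,1)` cut, hypothesis-free**: `TetraExcessZero → TetraPlusTwo → ω = 2` — the deciding term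
of the proposed re-cut `closes (hA : TetraExcessZero) (hB : TetraPlusTwo)`. [cite: Coppersmith1982, Thm. 1] -/
theorem matrixMultiplication_of_excessZero_of_plusTwo' (hA : TetraExcessZero)
    (hB : omega ℂ + 2 ≤ omegaTetra ℂ) : _root_.MatrixMultiplication :=
  matrixMultiplication_of_excessZero_of_plusTwo hA hB alphaPos

/-- **`ω = 2 ⟺ TetraExcessZero ∧ TetraPlusTwo`**, no side condition (both conjuncts NEC, jointly
sufficient). [cite: Coppersmith1982, Thm. 1] -/
theorem matrixMultiplication_iff_excessZero_and_plusTwo' :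
    _root_.MatrixMultiplication ↔ TetraExcessZero ∧ omega ℂ + 2 ≤ omegaTetra ℂ :=
  matrixMultiplication_iff_excessZero_and_plusTwo alphaPos

/-- **The `(2,2)` cut, hypothesis-free**: `A_2 → TetraNoSaving → ω = 2`. [cite: Coppersmith1982, Thm. 1] -/
theorem matrixMultiplication_of_doubleDefect_of_tetraNoSaving'
    (hA : omegaTetra ℂ + 4 ≤ 2 * omegaRect ℂ 2 1 2) (hB : TetraNoSaving) : _root_.MatrixMultiplication :=
  matrixMultiplication_of_doubleDefect_of_tetraNoSaving hA hB alphaPos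

/-- **`ω = 2 ⟺ A_2 ∧ TetraNoSaving`**, no side condition. [cite: Coppersmith1982, Thm. 1] -/
theorem matrixMultiplication_iff_doubleDefect_and_tetraNoSaving' :
    _root_.MatrixMultiplication ↔ omegaTetra ℂ + 4 ≤ 2 * omegaRect ℂ 2 1 2 ∧ TetraNoSaving :=
  matrixMultiplication_iff_doubleDefect_and_tetraNoSaving alphaPos

/-- **Floor of the residual against the attacked leaf of record**: `TetraExcessZero ∧ B_c ⟹ ω = 2` for every
`c ≥ 0.792`, unconditionally. [cite: Coppersmith1982, Thm. 1] -/
theorem matrixMultiplication_of_excessZero_of_transferGE_floor {c : ℝ} (hc : 0.792 ≤ c)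
    (hA : TetraExcessZero) (hB : 4 + c * (omega ℂ - 2) ≤ omegaTetra ℂ) : _root_.MatrixMultiplication :=
  _root_.MatrixMultiplication_iff.2 (omega_eq_two_of_excessZero_of_transferGE_floor ℂ hc hA hB)

/-- `ω = 2 ⟺ TetraExcessZero ∧ B_c` for every `c ≥ 0.792`, unconditionally. [cite: Coppersmith1982, Thm. 1] -/
theorem matrixMultiplication_iff_excessZero_and_transferGE_floor {c : ℝ} (hc : 0.792 ≤ c) :
    _root_.MatrixMultiplication ↔ TetraExcessZero ∧ 4 + c * (omega ℂ - 2) ≤ omegaTetra ℂ :=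
  ⟨fun hS => ⟨excessZero_of_matrixMultiplication hS, transferGE_of_matrixMultiplication c hS⟩,
    fun h => matrixMultiplication_of_excessZero_of_transferGE_floor hc h.1 h.2⟩

/-- **Floor of the attacked leaf against the residual of record**: `A_k ∧ TetraNoSaving ⟹ ω = 2` for every
`0 ≤ k ≤ 2.525`, unconditionally. [cite: Coppersmith1982, Thm. 1] -/
theorem matrixMultiplication_of_defectRatioLE_of_tetraNoSaving_floor {k : ℝ} (hk : 0 ≤ k)
    (hk' : k ≤ 2.525) (hA : omegaTetra ℂ - 4 ≤ k * (omegaRect ℂ 2 1 2 - 4)) (hB : TetraNoSaving) :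
    _root_.MatrixMultiplication :=
  _root_.MatrixMultiplication_iff.2 (omega_eq_two_of_defectRatioLE_of_noSaving_floor ℂ hk hk' hA hB)

end Route

end Summit.MatrixMultiplication.MatrixMultiplication.Theorems.EdgePencil

end
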